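import Mathlib
import Summits.ResolutionOfSingularities.ResolutionOfSingularities.Theorems.WeightedInvariantLocalWeightedDropWildMonicKangarooShearCases

/-!
# `WeightedInvariant.LocalWeightedDrop`, line `hasse-ridge-face-selection`, S3ρ flag line (Uk-ρD3 `DropAxisKangaroo`):
# Perlega's Prop. 6.2.3 for tuples along a GENERAL SHEAR `y ↦ y + φ(x)` — the wild case and the bound

Crux item stmt-ResolutionOfSingularities-8899 `LocalWeightedDrop` (route `ResolutionOfSingularities/WeightedInvariant`), engine of the
door `HypersurfaceCentreConstruction` stmt-ResolutionOfSingularities-19897.  [OURS · L1 W4.3, chain w43, seat res-type-056 ((C8) D-d KANGAROO →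
Uk-ρD3).  MODEL: S. Perlega, arXiv:2011.14443 Ch. 6 §2.1 Prop. 6.2.3 [cite: Perlega2020, Prop. 6.2.3 proof (∗) and the cases
`ỹ`-clean / `(1)_w`].  This file is `…WildMonicKangarooBound` VERBATIM with the monomial twist `subst (twist x y n t)` replaced by
stub-1's general shear `subst (PurePowerFlag.shift φ)` (letters `0, 1`; `w 0 = 1`, `w 1 = n ≥ 1`; `∀ m < n, [x^m]φ = 0`, `[xⁿ]φ = c ≠ 0`) — the
form in which res-L1-w43-stub-3's flag family presents a tangent flag (`flagTuple d A g h = shift d (A ∘ PurePowerFlag.shift h) g`); every proof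
goes through the shear lemmas of `…WildMonicKangarooShear` instead of the twist lemmas.  Nothing here is a statement of H. Hironaka's
manuscript [claim: Hironaka2017, status: under-review]; OUR lemmas.]

* `pshift_dStar_shift_le_of_caseThree` — the wild case `¬(1)_w ∧ ¬(2)_w ∧ (3)_w` (Hasse chain, equality killed by Lemma 6.2.2);
* `pshift_dStar_shift_le` — PROP. 6.2.3 (2)(4): `IsWClean p w A`, `wMin w A ≤ d!·ord_w g` ⇒
  `dStar 1 w (shift d (A ∘ shift φ) g) ≤ dInit w (newtonSet A) + d!/p ∧ (dInit < d! → dStar < d!)`; `pshift_dStar_shift_le_dInit_add`,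
  `pshift_dStar_shift_lt_factorial`.  AI-written; gate-accepted means sorry-free, not refereed.
-/

set_option linter.dupNamespace false -- mandated namespace of this single-conjunct summit

noncomputable section

namespace Summit.ResolutionOfSingularities.ResolutionOfSingularities.Theorems

namespace WildMonic

open MvPowerSeries MonicDescent Literature.RingTheory.MvPowerSeries

variable {k : Type} [Field k]

section Wild

variable {w : Fin 2 → ℕ} {n : ℕ} (hw0 : w 0 = 1) (hw1 : w 1 = n) (hn : 1 ≤ n) {φ : PowerSeries k} {c : k}
  (hφ : ∀ m, m < n → PowerSeries.coeff m φ = 0) (hc : PowerSeries.coeff n φ = c) (hc0 : c ≠ 0)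
  {d : ℕ} (A : Fin d → MvPowerSeries (Fin 2) k) (g : MvPowerSeries (Fin 2) k) (p : ℕ) [Fact p.Prime] [CharP k p]

include hw0 hw1 hn hφ hc hc0 in
/-- THE WILD CASE `¬(1)_w ∧ ¬(2)_w ∧ (3)_w` WITH `d!·ord_w g = m` (Perlega, Prop. 6.2.3 proof, last case): the slot `d − q` of `B̃` carries
`H = in_w(B_{d−q}) + C(d,q)·in_w(g)^q`; with `r = p^e < q` such that every exponent of the flattening `P` of `in_w(A_{d−q})` is divisible by `r` and
`∂_r P ≠ 0`: `∂_{y^r} H = ∂_{y^r} in_w(B_{d−q}) ≠ 0`, `ord_{(y)} H ≤ ord_{(y)} ∂_{y^r} H + r ≤ (deg P − tdeg P) + r`, hence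
`d_*(B̃) ≤ dInit + (d!/q)·r ≤ dInit + d!/p`; and if `dInit < d!` the equality `ord = q` is excluded by Lemma 6.2.2, so `d_*(B̃) < d!`. -/
theorem pshift_dStar_shift_le_of_caseThree {m : ℕ} (hm : wMin w A = m) (heq : wMin w A = (d.factorial : ℕ∞) * g.weightedOrder w)
    (hno : ∀ j : Fin d, d - qOf p d < (j : ℕ) → wMin w A < slotWOrd w A j)
    {i : Fin d} (hiq : (i : ℕ) = d - qOf p d) (hi : slotWOrd w A i = wMin w A)
    (h3 : ∃ e ∈ initSupp w (A i), ¬ (qOf p d ∣ e 0 ∧ qOf p d ∣ e 1)) :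
    dStar 1 w (shift d (fun j => subst (PurePowerFlag.shift φ) (A j)) g) ≤ ((dInit w (newtonSet A) + d.factorial / p : ℕ) : ℕ∞) ∧
      (dInit w (newtonSet A) < d.factorial → dStar 1 w (shift d (fun j => subst (PurePowerFlag.shift φ) (A j)) g) < (d.factorial : ℕ∞)) := by
  classical
  have hxy : (0 : Fin 2) ≠ 1 := fin2_zero_ne_one
  have hp : p.Prime := Fact.out
  have hm' : wMin w A ≠ ⊤ := by rw [hm]; exact ENat.coe_ne_top m
  have hd : 0 < d := Fin.pos i
  set B : Fin d → MvPowerSeries (Fin 2) k := fun j => subst (PurePowerFlag.shift φ) (A j) with hBdef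
  have hmB : wMin w B = wMin w A := wMin_pshift hw0 hw1 hn hφ hc A
  have hslotB : ∀ j, slotWOrd w B j = slotWOrd w A j := fun j => by rw [hBdef, slotWOrd_pshift hw0 hw1 hn hφ hc A j]
  have hmB' : wMin w B ≠ ⊤ := by rw [hmB]; exact hm'
  have heqB : wMin w B = (d.factorial : ℕ∞) * g.weightedOrder w := by rw [hmB]; exact heq
  have hg : g ≠ 0 := ne_zero_of_factorial_mul_eq w B g hmB' heqB
  have hq : d - (i : ℕ) = qOf p d := by have := Nat.le_of_dvd hd (qOf_dvd p d); omega
  have hsq : slotWeight d i * qOf p d = d.factorial := by rw [← hq]; exact slotWeight_mul_sub i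
  -- the slot `i = d − q` of `A`: weight `W`, flattening `P`
  obtain ⟨hAi, W, hWi, hWm⟩ := exists_weightedOrder_eq_of_attains w A hi hm'
  have hW : ((A i).weightedOrder w).toNat = W := by rw [hWi, ENat.toNat_coe]
  have hhom : IsWeightedHomogeneous w (inW w (A i)) W := by rw [← hW]; exact isWeightedHomogeneous_inW w (A i)
  set P := flatPoly 0 1 n W (inW w (A i)) with hPdef
  have hP0 : P ≠ 0 := fun h => inW_ne_zero w hAi ((flatPoly_eq_zero_iff hxy hw0 hw1 hn hhom).mp h)
  -- `W = q·γ`, `γ = ord_w g`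
  have hgfin : g.weightedOrder w ≠ ⊤ := (weightedOrder_eq_top_iff w).not.mpr hg
  set γ := (g.weightedOrder w).toNat with hγ
  have hγeq : g.weightedOrder w = γ := (ENat.coe_toNat hgfin).symm
  have hWq : W = qOf p d * γ := by
    have h : (slotWeight d i : ℕ∞) * (W : ℕ∞) = (slotWeight d i : ℕ∞) * ((qOf p d * γ : ℕ) : ℕ∞) := by
      rw [hWm, heq, hγeq, ← hsq]; push_cast; ring
    exact_mod_cast eq_of_slotWeight_mul_eq i h
  -- an exponent of `P` not divisible by `q`
  have hex : ∃ j ∈ P.support, ¬ qOf p d ∣ j := by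
    obtain ⟨e, he, hnd⟩ := h3
    have hce := (coeff_inW_ne_zero_iff w (A i) e).mpr he
    obtain ⟨hwe, heq'⟩ := eq_single_add_single_of_coeff_ne_zero hxy hw0 hw1 hhom hce
    refine ⟨e 1, (mem_support_flatPoly_iff (x := 0) (y := 1) (W := W) (G := inW w (A i)) hn (e 1)).mpr ⟨by omega, by rw [← heq']; exact hce⟩,
      fun hdy => hnd ?_⟩
    have hdx : qOf p d ∣ e 0 := by
      have h1 : e 0 = W - n * e 1 := by omega
      rw [h1, hWq]; exact Nat.dvd_sub (Dvd.intro _ rfl) (Dvd.dvd.mul_left hdy n)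
    exact ⟨hdx, hdy⟩
  -- Lemma 6.2.1 (6): `r = p^e`, `∂_r P ≠ 0`
  obtain ⟨e, hea, hdiv, hQ⟩ := exists_hasseDeriv_prime_pow_ne_zero (k := k) p (a := d.factorization p) hex
  -- univariate bookkeeping (before naming `r`, `Q`, `τ`, so that the abbreviations propagate)
  have h1 := natTrailingDegree_taylor_add_le hc0 hQ
  have h2 := hasseDeriv_shift_sub_le (p ^ e) hQ
  set r := p ^ e with hr
  set Q := Polynomial.hasseDeriv r P with hQdef
  have hrW : n * r ≤ W := by
    have h1 : r ≤ P.natDegree := by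
      by_contra hlt; exact hQ (Polynomial.hasseDeriv_eq_zero_of_lt_natDegree P r (not_le.mp hlt))
    have h2 := natDegree_flatPoly_le 0 1 n W (inW w (A i))
    exact (le_div_iff_mul_le' hn).mp (h1.trans h2)
  -- the twisted form and its derivative
  have hB0 : B i ≠ 0 := subst_pshift_ne_zero hw0 hw1 hn hφ hc hAi
  have hWB : (B i).weightedOrder w = W := by rw [hBdef]; simp only; rw [weightedOrder_subst_pshift hw0 hw1 hn hφ hc hAi, hWi]
  have hWB' : ((B i).weightedOrder w).toNat = W := by rw [hWB, ENat.toNat_coe]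
  have hhomB : IsWeightedHomogeneous w (inW w (B i)) W := by rw [← hWB']; exact isWeightedHomogeneous_inW w (B i)
  have hflatB : flatPoly 0 1 n W (inW w (B i)) = Polynomial.taylor c P := flatPoly_inW_subst_pshift hw0 hw1 hn hφ hc hAi hW
  have hhomD : IsWeightedHomogeneous w (hasseDeriv (Finsupp.single 1 r) (inW w (B i))) (W - n * r) :=
    isWeightedHomogeneous_hasseDeriv_single hxy hw0 hw1 hhomB r
  have hflatD : flatPoly 0 1 n (W - n * r) (hasseDeriv (Finsupp.single 1 r) (inW w (B i))) = Polynomial.taylor c Q := by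
    rw [flatPoly_hasseDeriv_single hxy hn _ hrW, hflatB, hQdef, hasseDeriv_taylor_comm]
  have hTQ0 : Polynomial.taylor c Q ≠ 0 := fun h => hQ ((Polynomial.taylor_eq_zero _ _).mp h)
  have hD0 : hasseDeriv (Finsupp.single 1 r) (inW w (B i)) ≠ 0 := fun h => hTQ0 (by
    rw [← hflatD, h]; exact (flatPoly_eq_zero_iff hxy hw0 hw1 hn (G := (0 : MvPowerSeries (Fin 2) k)) (W := W - n * r)
      (fun {_} h0 => absurd (MvPowerSeries.coeff_zero _) h0)).mpr rfl)
  -- the top form `C(d,q)·in_w(g)^q` is killed by `∂_{y^r}` (`r < q`)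
  have hkill0 : hasseDeriv (Finsupp.single 1 r) ((inW w g) ^ p ^ d.factorization p) = 0 :=
    hasseDeriv_pow_char_pow_eq_zero_of_not_dvd p ⟨1, by
      rw [Finsupp.single_eq_same, hr, Nat.pow_dvd_pow_iff_le_right hp.one_lt]; omega⟩ _
  have hkill : hasseDeriv (Finsupp.single 1 r) (MvPowerSeries.C ((d.choose i : ℕ) : k) * (inW w g) ^ (d - (i : ℕ))) = 0 := by
    rw [hq, show qOf p d = p ^ d.factorization p from rfl, ← smul_eq_C_mul, map_smul, hkill0, smul_zero]
  -- the slot `d − q` of `B̃`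
  set H := weightedHomogeneousComponent w W (B i) + MvPowerSeries.C ((d.choose i : ℕ) : k) * (inW w g) ^ (d - (i : ℕ)) with hHdef
  have hHcomp : weightedHomogeneousComponent w W (B i) = inW w (B i) := component_eq_inW_of_eq w hWB
  have hDH : hasseDeriv (Finsupp.single 1 r) H = hasseDeriv (Finsupp.single 1 r) (inW w (B i)) := by
    rw [hHdef, map_add, hkill, add_zero, hHcomp]
  have hH0 : H ≠ 0 := fun h => hD0 (by rw [← hDH, h, map_zero])
  have hV : (slotWeight d i : ℕ∞) * (W : ℕ∞) = wMin w B := by rw [hmB, ← hWm]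
  obtain ⟨hatt, hin⟩ := inW_shift_slot_sub_qOf w B g p hiq hmB' heqB (fun j hj => by rw [hslotB, hmB]; exact hno j hj) hV hH0
  -- the `y`-order of `H`
  set τ := (Polynomial.taylor c Q).natTrailingDegree with hτ
  have hordD : (hasseDeriv (Finsupp.single 1 r) (inW w (B i))).weightedOrder (Pi.single 1 1) = (τ : ℕ) := by
    rw [weightedOrder_single_eq_natTrailingDegree hxy hw0 hw1 hn hhomD hD0, hflatD]
  have hordH : (inW w (shift d B g i)).weightedOrder (Pi.single 1 1) ≤ ((τ + r : ℕ) : ℕ∞) := by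
    rw [hin]
    calc H.weightedOrder (Pi.single 1 1)
        ≤ (hasseDeriv (Finsupp.single 1 r) H).weightedOrder (Pi.single 1 1) + r := weightedOrder_single_le_hasseDeriv_add hxy H r
      _ = ((τ + r : ℕ) : ℕ∞) := by rw [hDH, hordD, Nat.cast_add]
  have hsp := mul_spread_le_dInit hxy hw0 hw1 hn A hm hi hW
  have hτδ : τ ≤ P.natDegree - P.natTrailingDegree := by omega
  have hbound : dStar 1 w (shift d B g) ≤ ((slotWeight d i * (τ + r) : ℕ) : ℕ∞) := by
    calc dStar 1 w (shift d B g) ≤ (slotWeight d i : ℕ∞) * (inW w (shift d B g i)).weightedOrder (Pi.single 1 1) :=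
          dStar_le 1 w _ (attains_shift_of_slot w B g heqB.le hatt)
      _ ≤ (slotWeight d i : ℕ∞) * ((τ + r : ℕ) : ℕ∞) := by gcongr
      _ = ((slotWeight d i * (τ + r) : ℕ) : ℕ∞) := by rw [Nat.cast_mul]
  -- `s_i · r ≤ d!/p` (`r ≤ q/p`)
  have hsr : slotWeight d i * r ≤ d.factorial / p := by
    have ha : 1 ≤ d.factorization p := by omega
    have hrq : r * p ≤ qOf p d := by
      rw [hr, show qOf p d = p ^ d.factorization p from rfl, ← pow_succ]
      exact Nat.pow_le_pow_right hp.pos (by omega)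
    rw [Nat.le_div_iff_mul_le hp.pos, ← hsq, mul_assoc]
    exact Nat.mul_le_mul_left _ hrq
  refine ⟨hbound.trans ?_, fun hlt => lt_of_le_of_lt hbound ?_⟩
  · rw [Nat.cast_le, Nat.mul_add]
    exact add_le_add ((Nat.mul_le_mul_left _ hτδ).trans hsp) hsr
  · -- (4): `s_i (τ + r) < d! = s_i q`, i.e. `τ + r < q`; equality is excluded by Lemma 6.2.2
    rw [Nat.cast_lt, ← hsq]
    refine (Nat.mul_lt_mul_left (slotWeight_pos i)).mpr ?_
    have hδq : P.natDegree - P.natTrailingDegree < qOf p d := by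
      refine Nat.lt_of_mul_lt_mul_left (a := slotWeight d i) ?_
      rw [hsq]; exact lt_of_le_of_lt hsp hlt
    have hrδ : r ∣ P.natDegree - P.natTrailingDegree := dvd_natDegree_sub_natTrailingDegree hP0 hdiv
    set b := d.factorization p - e with hb
    have hb1 : 1 ≤ b := by omega
    have hqr : qOf p d = r * p ^ b := by
      rw [hr, ← pow_add, show e + b = d.factorization p by omega]; rfl
    have hqr' : qOf p d - r = r * (p ^ b - 1) := by rw [hqr, Nat.mul_sub_one]
    have hδle : P.natDegree - P.natTrailingDegree ≤ qOf p d - r := by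
      obtain ⟨u, hu⟩ := hrδ
      rw [hu, hqr] at hδq
      rw [hu, hqr', ]
      exact Nat.mul_le_mul_left r (by have := Nat.lt_of_mul_lt_mul_left hδq; omega)
    have hrq : r ≤ qOf p d := by rw [hqr]; exact Nat.le_mul_of_pos_right r (pow_pos hp.pos b)
    have hPdeg := P.natTrailingDegree_le_natDegree
    have hQdeg := Q.natTrailingDegree_le_natDegree
    by_contra hge
    push Not at hge
    have hτQ : τ + Q.natTrailingDegree = Q.natDegree := by omega
    have hQform := eq_C_mul_X_pow_mul_pow_of_natTrailingDegree_taylor hc0 hQ hτQ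
    have hexp : Q.natDegree - Q.natTrailingDegree = p ^ e * (p ^ b - 1) := by rw [← hr, ← hqr']; omega
    rw [hexp, sub_eq_add_neg, ← map_neg] at hQform
    exact hasseDeriv_ne_C_mul_X_pow_mul_pow p hb1 hdiv (Polynomial.leadingCoeff_ne_zero.mpr hQ) (neg_ne_zero.mpr hc0) _ hQform

include hw0 hw1 hn hφ hc hc0 in
/-- PERLEGA'S PROP. 6.2.3 (2) AND (4) FOR TUPLES (cleanness-free on the re-centring): for a `w`-clean tuple `A` with `m = wMin w A < ⊤`, its twist
`B` to the subordinate coordinates of the flag curve `y + t xⁿ = 0` (`t ≠ 0`), and ANY re-centring `g` there with `d!·ord_w g ≥ m`: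
(2) `d_*(shift d B g) ≤ dInit w (newtonSet A) + d!/p`;  (4) if `dInit w (newtonSet A) < d!` then `d_*(shift d B g) < d!`. -/
theorem pshift_dStar_shift_le {m : ℕ} (hm : wMin w A = m) (hclean : IsWClean p w A)
    (hG : wMin w A ≤ (d.factorial : ℕ∞) * g.weightedOrder w) :
    dStar 1 w (shift d (fun j => subst (PurePowerFlag.shift φ) (A j)) g) ≤ ((dInit w (newtonSet A) + d.factorial / p : ℕ) : ℕ∞) ∧
      (dInit w (newtonSet A) < d.factorial → dStar 1 w (shift d (fun j => subst (PurePowerFlag.shift φ) (A j)) g) < (d.factorial : ℕ∞)) := by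
  have hm' : wMin w A ≠ ⊤ := by rw [hm]; exact ENat.coe_ne_top m
  have tame : dStar 1 w (shift d (fun j => subst (PurePowerFlag.shift φ) (A j)) g) ≤ (dInit w (newtonSet A) : ℕ) →
      dStar 1 w (shift d (fun j => subst (PurePowerFlag.shift φ) (A j)) g) ≤ ((dInit w (newtonSet A) + d.factorial / p : ℕ) : ℕ∞) ∧
        (dInit w (newtonSet A) < d.factorial →
          dStar 1 w (shift d (fun j => subst (PurePowerFlag.shift φ) (A j)) g) < (d.factorial : ℕ∞)) :=
    fun h => ⟨h.trans (by exact_mod_cast Nat.le_add_right _ _), fun hlt => lt_of_le_of_lt h (by exact_mod_cast hlt)⟩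
  rcases hG.lt_or_eq with hlt | heq
  · exact tame (pshift_dStar_shift_le_of_lt hw0 hw1 hn hφ hc hc0 A g hm hlt)
  · by_cases h1 : ∃ i : Fin d, d - qOf p d < (i : ℕ) ∧ slotWOrd w A i = wMin w A
    · exact tame (pshift_dStar_shift_le_of_caseOne hw0 hw1 hn hφ hc hc0 A g p hm heq h1)
    · push Not at h1
      have hno : ∀ j : Fin d, d - qOf p d < (j : ℕ) → wMin w A < slotWOrd w A j :=
        fun j hj => lt_of_le_of_ne (wMin_le_slotWOrd w A j) fun h => h1 j hj h.symm
      have hd : 0 < d := pos_of_wMin_ne_top w A hm'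
      have hqd : qOf p d ≤ d := Nat.le_of_dvd hd (qOf_dvd p d)
      have hq1 : 0 < qOf p d := qOf_pos p d
      obtain ⟨i, hiq⟩ : ∃ i : Fin d, (i : ℕ) = d - qOf p d := ⟨⟨d - qOf p d, by omega⟩, rfl⟩
      by_cases h2 : slotWOrd w A i = wMin w A
      · -- `(3)_w` is the only clause of cleanness left
        have h3 : ∃ e ∈ initSupp w (A i), ¬ (qOf p d ∣ e 0 ∧ qOf p d ∣ e 1) := by
          rcases hclean with ⟨i', hi', hatt'⟩ | hcase2 | ⟨i', e, hi', he, hnd⟩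
          · exact absurd hatt' (h1 i' hi')
          · exact absurd h2 (ne_of_gt (hcase2 i hiq))
          · have hii : i' = i := Fin.ext (by rw [hi', hiq])
            rw [hii] at he
            exact ⟨e, he, hnd⟩
        exact pshift_dStar_shift_le_of_caseThree hw0 hw1 hn hφ hc hc0 A g p hm heq hno hiq h2 h3
      · rcases le_or_gt ((d.factorial : ℕ∞) * (inW w g).weightedOrder (Pi.single 1 1))
            (dStar 1 w (fun j => subst (PurePowerFlag.shift φ) (A j))) with hle | hlt'
        · exact tame (pshift_dStar_shift_le_of_not_attains hw0 hw1 hn hφ hc hc0 A g p hm heq hno hiq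
            (lt_of_le_of_ne (wMin_le_slotWOrd w A i) (Ne.symm h2)) hle)
        · exact tame (pshift_dStar_shift_le_dStar_of_yMin hw0 hw1 hn hφ hc hc0 A g hm heq hlt')

include hw0 hw1 hn hφ hc hc0 in
/-- PROP. 6.2.3 (2) alone: `d_*(shift d B g) ≤ dInit w (newtonSet A) + d!/p`. -/
theorem pshift_dStar_shift_le_dInit_add {m : ℕ} (hm : wMin w A = m) (hclean : IsWClean p w A)
    (hG : wMin w A ≤ (d.factorial : ℕ∞) * g.weightedOrder w) :
    dStar 1 w (shift d (fun j => subst (PurePowerFlag.shift φ) (A j)) g) ≤ ((dInit w (newtonSet A) + d.factorial / p : ℕ) : ℕ∞) :=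
  (pshift_dStar_shift_le hw0 hw1 hn hφ hc hc0 A g p hm hclean hG).1

include hw0 hw1 hn hφ hc hc0 in
/-- PROP. 6.2.3 (4), THE INSTANCE USED BY PROP. 9.1.4 CASE (4): `dInit w (newtonSet A) < d! ⇒ d_*(shift d B g) < d!`. -/
theorem pshift_dStar_shift_lt_factorial {m : ℕ} (hm : wMin w A = m) (hclean : IsWClean p w A)
    (hG : wMin w A ≤ (d.factorial : ℕ∞) * g.weightedOrder w) (hlt : dInit w (newtonSet A) < d.factorial) :
    dStar 1 w (shift d (fun j => subst (PurePowerFlag.shift φ) (A j)) g) < (d.factorial : ℕ∞) :=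
  (pshift_dStar_shift_le hw0 hw1 hn hφ hc hc0 A g p hm hclean hG).2 hlt

end Wild

end WildMonic

end Summit.ResolutionOfSingularities.ResolutionOfSingularities.Theorems

end
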